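import Literature.MathematicalPhysics.QuantumFieldTheory.Balaban1983to89.B4Thm110BoxCut
import Literature.MathematicalPhysics.QuantumFieldTheory.Balaban1983to89.B4Thm110BoxDerivWalk

/-!
# `Balaban1983to89.B4Thm110BoxDerivCut` — [Balaban1983RegularityDecay] THEOREM p. 573, (1.10) DERIVATIVE member
# `|(D^η_{A,μ}G_k(Ω,A)f)(x)| ≤ c₀e^{−δ₀dist(x,supp f)}‖f‖_∞`, ON A BOX `Ω` WITH THE PRINT's CUT CUBES `□_j` (p. 575) —
# r01's probe route `B4Ineq19WalkRoute.probe_bound` with `S_j := □_j`, `G_j := pad(G_k(□_j,Ã_j)) + cinv`, the per-cube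
# input `α_P` reduced BY PADDING to p17 g4's Leibniz estimate on the sub-box (uniform in `η` and in `Ω`)

statement-level skeleton of published theorems with citation tags; proofs where landed; nothing here is a claim about the Yang–Mills mass gap

CITATION HEADER.  T. Bałaban, *Regularity and decay of lattice Green's functions*, Commun. Math. Phys. **89** (1983)
571–597, doi:10.1007/bf01214744 [Balaban1983RegularityDecay] (cell paper B4; held text
`paper:balaban1983-cmp89-regularity-decay`, journal page = PDF page + 570; pp. 572–573, 575–579).  Unit `lit-balaban-p17`
gen 5 (Phase-2 proof seat p17; HOME `run/shared/lean/pub/lit-balaban/`), SKELETON rows **B4.Thm@573** ((1.10) derivative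
member, rectangular `Ω`), **B4.Eq2.2**, **B4.Eq2.18**.  Imports p17 g5 `B4Thm110BoxCut` (labels, cut cubes, `hCube_subEmb`,
`subField_cubeField`) and p17 g4 `B4Thm110BoxDerivWalk` (probe algebra `probe_mul_mulH`, `fld_probe_mulVec_self/_ne`,
`row_abs_sum_U_le`; → r01 g6 `B4Ineq19WalkRoute.probe_bound`).

WHAT IS PRINTED.  p. 573 (1.10), second member; (1.3) p. 572 `(D^η_{A,μ}φ)(x) = η^{-1}(U(A_{⟨x,x+ηe_μ⟩})φ(x+ηe_μ) −
φ(x))`; (2.3) p. 575 (Leibniz); p. 577 «|∂^ηh_j| ≤ O(M^{-1})»; p. 579 «if Ω is a rectangular parallelepiped, then all □_j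
… are cubes and we can apply Lemma 2.2 to all operators in it, so the restriction dist({x,x′},Ω^c) ≥ R₀ is unnecessary».

WHAT THIS MODULE PROVES (all in full; `Ω = Box d ℓ k Mb`, `n = (ℓ+1)^k`, `d ≥ 1`, `K ∣ Mb_μ`).
* §1 padding algebra for the probe: `pad_smul`, `unitOp_eq_pad` (`E_{e(a)e(b)}[B] = pad_e(E_{ab}[B])`), `probe_eq_pad`.
* §2 **`probe_letter_norm_le`** — p17 g4's Leibniz estimate as a LEMMA on an arbitrary box: for the probe
  `P = n(E_{ab}[U(κB_{ab})] − E_{aa}[1])`, `b = a + e_μ`, and any operator `G` with `‖GΦ‖_∞ ≤ c_G‖Φ‖_∞`,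
  `‖D^η_{B,μ}GΦ‖_∞ ≤ c_D‖Φ‖_∞`: `‖P·(h_jGh_j)‖ ≤ √N c_D + (s/K)·N√N c_G`, `s = (d+1)(sup|h′|+sup|h″|)`.
* §3 **`thm110_deriv_boxCut`** — THEOREM (1.10), derivative member, on `Ω` with the cut cubes: arbitrary `A`, cube
  configurations `Ã_j` agreeing with `A` on the plateaus, per-cube inputs ON THE SUB-BOXES (`c_G`, `c_D`: Lemma 2.2 (2.17)
  `n = 0,1` for `G_k(□_j, Ã_j|□_j)`; `c_K`: (2.20)), `3^{d+1}√N c_K ≤ e^{−1}`; conclusion for `x, x+e_μ ∈ Ω` and `f`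
  supported at sup-distance `≥ D` from `x`: `|(D^η_{A,μ}G_k(Ω,A)f)(x)_i| ≤ 2^{d+3}e^{19/8}·(√N c_D + (s/K)·N√N c_G)·e^{−D/K}·φ`
  — every `x` (no `R₀`).  **`thm110_deriv_boxCut_cubeField`**: the same for `A = compField Ac`, `Ã_j = cubeField Ω n K j
  (A₀ j) Ac`, inputs about `cubeField □_j n K (jloc j) (A₀ j) (Ac ∘ (· + n·cubeLo j))`.
HONEST SCOPE.  Derivative member only; forward bond `⟨x, x+e_μ⟩` inside `Ω`; `d ≥ 1`; per-cube inputs are hypotheses here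
(discharged uniformly in `Ω` in `B4Thm110BoxDerivUniform`).  No `def`, no `Prop` fact, no `sorry`; axioms standard.
-/

namespace Literature.MathematicalPhysics.QuantumFieldTheory.Balaban1983to89.B4Thm110BoxDerivCut

open Literature.MathematicalPhysics.QuantumFieldTheory.Balaban1983to89.B4Reflection242 (boxDom mem_boxDom nbrs mem_nbrs blk)
open Literature.MathematicalPhysics.QuantumFieldTheory.Balaban1983to89.B4GaugeCovariance
open Literature.MathematicalPhysics.QuantumFieldTheory.Balaban1983to89.B4Commutators25to211 (mulH opK)
open Literature.MathematicalPhysics.QuantumFieldTheory.Balaban1983to89.B4Lower18Regular (e1 baseEmb stairContour)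
open Literature.MathematicalPhysics.QuantumFieldTheory.Balaban1983to89.B4Lower18RegularRegion (compField)
open Literature.MathematicalPhysics.QuantumFieldTheory.Balaban1983to89.B4Lemma21Region (siteNorm covDeriv
  fld_covDeriv_mulVec_of_mem)
open Literature.MathematicalPhysics.QuantumFieldTheory.Balaban1983to89.B4Lemma22ReduceZero (Box opA greenA derivA)
open Literature.MathematicalPhysics.QuantumFieldTheory.Balaban1983to89.B4Lemma22Reduce231 (supN supN_nonneg le_supN
  supN_le siteNorm_nonneg siteNorm_zero fld_zero)
open Literature.MathematicalPhysics.QuantumFieldTheory.Balaban1983to89.B4Lemma22Invertible (opA_stair_isUnit_det)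
open Literature.MathematicalPhysics.QuantumFieldTheory.Balaban1983to89.B4PartitionUnity22 (hCube hCube_nonneg hCube_le_one
  hCube_ne_zero_imp mem_box_of_hCube_ne_zero hprof D1 D2 D1_nonneg D2_nonneg contDiff_hprof hasCompactSupport_hprof)
open Literature.MathematicalPhysics.QuantumFieldTheory.Balaban1983to89.B4Green242Bridge (boxNbrs)
open Literature.MathematicalPhysics.QuantumFieldTheory.Balaban1983to89.B4Eq220CommutatorZeroBox (HSize mem_boxNbrs_iff)
open Literature.MathematicalPhysics.QuantumFieldTheory.Balaban1983to89.B4Eq220PartitionSizes (hBox hsize_hBox)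
open Literature.MathematicalPhysics.QuantumFieldTheory.Balaban1983to89.B4Eq220CommutatorField (kOp)
open Literature.MathematicalPhysics.QuantumFieldTheory.Balaban1983to89.B4Ineq110WalkRoute (norm_mulH_le)
open Literature.MathematicalPhysics.QuantumFieldTheory.Balaban1983to89.B4Ineq110WalkRouteDeriv (unitOp_apply
  unitOp_mul_mulH norm_unitOp_le fld_bondOp_mulVec)
open Literature.MathematicalPhysics.QuantumFieldTheory.Balaban1983to89.B4Ineq19WalkRoute (probe_bound)
open Literature.MathematicalPhysics.QuantumFieldTheory.Balaban1983to89.B4CubeOpReindex (pad pad_apply_img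
  pad_apply_of_left pad_apply_of_right pad_sub pad_mul norm_pad linfty_opNorm_le_of_supN)
open Literature.MathematicalPhysics.QuantumFieldTheory.Balaban1983to89.B4SubBoxCarrier (subEmb inSub inSub_iff
  subEmb_injective)
open Literature.MathematicalPhysics.QuantumFieldTheory.Balaban1983to89.B4CubeGreenBox (subField cubeW cubeT cubeGreen
  cubeOp_mul_cubeGreen cube_letter_a cube_letter_b)
open Literature.MathematicalPhysics.QuantumFieldTheory.Balaban1983to89.B4BoxCubeGeometry (posR cubeLo cubeMs cube_ho cubeS
  cubeS_of_near cubeS_of_plateau cubeS_of_hCube_ne_zero boxWt_local blkWt_local contourTrans_plateau)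
open Literature.MathematicalPhysics.QuantumFieldTheory.Balaban1983to89.B4Thm110BoxWalk (plateau_fine hCube_posR_eq_hBox)
open Literature.MathematicalPhysics.QuantumFieldTheory.Balaban1983to89.B4CubeFields22 (cubeField cubeField_eq_compField)
open Literature.MathematicalPhysics.QuantumFieldTheory.Balaban1983to89.B4Thm110BoxDerivWalk (probe_mul_mulH
  fld_probe_mulVec_self fld_probe_mulVec_ne row_abs_sum_U_le)
open Literature.MathematicalPhysics.QuantumFieldTheory.Balaban1983to89.B4Thm110BoxCut
open scoped Matrix
open scoped Matrix.Norms.Operator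

noncomputable section

variable {d : ℕ}
variable {ι : Type} [Fintype ι] [DecidableEq ι]

/-! ## §1. Padding algebra for the probe -/

section Pad

variable {X X' : Type} [DecidableEq X] [Fintype X'] [DecidableEq X']

omit [Fintype ι] [DecidableEq ι] [DecidableEq X'] in
/-- padding is homogeneous. [cite: Balaban1983RegularityDecay, (2.2) p.575 (dictionary: operators on `□_j` acting on `Ω`)] -/
theorem pad_smul (e : X' → X) (r : ℝ) (B : Matrix (X' × ι) (X' × ι) ℝ) : pad e (r • B) = r • pad e B := by
  ext p p'
  simp only [pad, Matrix.of_apply, Matrix.smul_apply, smul_eq_mul, Finset.mul_sum]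
  refine Finset.sum_congr rfl fun a _ => Finset.sum_congr rfl fun a' _ => ?_
  split_ifs <;> simp

omit [Fintype ι] [DecidableEq ι] in
/-- **A BLOCK MATRIX UNIT ON THE IMAGE IS THE PADDED UNIT**: `E_{e(a)e(b)}[B] = pad_e(E_{ab}[B])` (`e` injective).
[cite: Balaban1983RegularityDecay, (1.3) p.572 with (2.2) p.575, dictionary] -/
theorem unitOp_eq_pad {e : X' → X} (he : Function.Injective e) (a b : X') (B : Matrix ι ι ℝ) :
    unitOp (e a) (e b) B = pad e (unitOp a b B) := by
  ext p p'
  rw [unitOp_apply]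
  by_cases hp : ∃ c, e c = p.1
  · obtain ⟨c, hc⟩ := hp
    by_cases hp' : ∃ c', e c' = p'.1
    · obtain ⟨c', hc'⟩ := hp'
      have e1 : p = (e c, p.2) := Prod.ext hc.symm rfl
      have e2 : p' = (e c', p'.2) := Prod.ext hc'.symm rfl
      rw [e1, e2, pad_apply_img he, unitOp_apply]
      simp only [he.eq_iff]
    · rw [pad_apply_of_right e _ _ (fun c' h => hp' ⟨c', h⟩)]
      rw [if_neg]
      rintro ⟨-, h2⟩
      exact hp' ⟨b, h2.symm⟩
  · rw [pad_apply_of_left e _ (fun c h => hp ⟨c, h⟩)]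
    rw [if_neg]
    rintro ⟨h1, -⟩
    exact hp ⟨a, h1.symm⟩

omit [Fintype ι] in
/-- the derivative probe placed at an image bond is the padded probe of the sub-box.
[cite: Balaban1983RegularityDecay, (1.3) p.572, (2.2) p.575, dictionary] -/
theorem probe_eq_pad {e : X' → X} (he : Function.Injective e) (a b : X') (B : Matrix ι ι ℝ) (r : ℝ) :
    r • (unitOp (e a) (e b) B - unitOp (e a) (e a) (1 : Matrix ι ι ℝ))
      = pad e (r • (unitOp a b B - unitOp a a (1 : Matrix ι ι ℝ))) := by
  rw [pad_smul, pad_sub, unitOp_eq_pad he, unitOp_eq_pad he]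

end Pad

/-! ## §2. The per-cube input `α_P` of the probe route: the Leibniz estimate on a box -/

section Letter

omit [DecidableEq ι] in
/-- a row sum is at most the `ℓ^∞`-operator norm. [folklore] -/
private theorem row_sum_le_norm {m n : Type} [Fintype m] [Fintype n] (A : Matrix m n ℝ) (i : m) :
    ∑ j, |A i j| ≤ ‖A‖ := by
  rw [Matrix.linfty_opNorm_def]
  have h : (∑ j, ‖A i j‖₊ : NNReal) ≤ Finset.univ.sup fun i => ∑ j, ‖A i j‖₊ :=
    Finset.le_sup (f := fun i => ∑ j, ‖A i j‖₊) (Finset.mem_univ i)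
  have h' := NNReal.coe_le_coe.mpr h
  simp only [NNReal.coe_sum, coe_nnnorm, Real.norm_eq_abs] at h'
  exact h'

omit [DecidableEq ι] in
/-- `|(Af)_i| ≤ ‖A‖·sup|f|`. [folklore] -/
private theorem abs_mulVec_le {m n : Type} [Fintype m] [Fintype n] (A : Matrix m n ℝ) (f : n → ℝ) {φ : ℝ}
    (hφ : 0 ≤ φ) (hf : ∀ j, |f j| ≤ φ) (i : m) : |(A *ᵥ f) i| ≤ ‖A‖ * φ := by
  rw [Matrix.mulVec, dotProduct]
  calc |∑ j, A i j * f j| ≤ ∑ j, |A i j * f j| := Finset.abs_sum_le_sum_abs _ _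
    _ ≤ ∑ j, |A i j| * φ := Finset.sum_le_sum fun j _ => by
        rw [abs_mul]; exact mul_le_mul_of_nonneg_left (hf j) (abs_nonneg _)
    _ = (∑ j, |A i j|) * φ := by rw [Finset.sum_mul]
    _ ≤ ‖A‖ * φ := mul_le_mul_of_nonneg_right (row_sum_le_norm A i) hφ

omit [Fintype ι] [DecidableEq ι] in
/-- the labels whose `h_j` can see a point number at most `2^{d+1}`. [cite: Balaban1983RegularityDecay, §2 p.575] -/
private theorem card_labelBox_le (M : ℝ) (p : Fin (d + 1) → ℝ) :
    (Fintype.piFinset fun μ => ({⌊p μ / M⌋, ⌊p μ / M⌋ + 1} : Finset ℤ)).card ≤ 2 ^ (d + 1) := by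
  rw [Fintype.card_piFinset]
  calc ∏ μ, ({⌊p μ / M⌋, ⌊p μ / M⌋ + 1} : Finset ℤ).card ≤ 2 ^ (Finset.univ : Finset (Fin (d + 1))).card :=
        Finset.prod_le_pow_card _ _ 2 fun μ _ => Finset.card_le_two
    _ = 2 ^ (d + 1) := by rw [Finset.card_univ, Fintype.card_fin]

/-- **THE PER-CUBE INPUT `α_P` OF THE PROBE ROUTE BY THE LEIBNIZ RULE (2.3), ON A BOX** (p17 g4's estimate as a lemma):
box `□ = Box d ℓ k M` (`K ∣ M_μ`, `nK ≥ 3`), a bond field `B` on it, the label `j` with `h_j = hCube K j ∘ posR` ([B4]'s `h`,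
sizes `hsize_hBox`: `η^{-1}|h_j(b) − h_j(a)| ≤ s/K`), an operator `G` with `‖GΦ‖_∞ ≤ c_G‖Φ‖_∞` and `‖D^η_{B,μ}GΦ‖_∞ ≤
c_D‖Φ‖_∞`, and the probe `P = n(E_{ab}[U(κB_{ab})] − E_{aa}[1])` at a bond `b = a + e_μ` of the box:
`‖P·(h_jGh_j)‖ ≤ √N c_D + (s/K)·N√N c_G` — `P·h_j = h_j(a)P + n(h_j(b) − h_j(a))E_{ab}[U]` (2.3).
[cite: Balaban1983RegularityDecay, (2.3) p.575, p.577 «|∂^ηh_j| ≤ O(M^{-1})», (2.18) p.578] -/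
theorem probe_letter_norm_le (F : OrthFlow ι) (κ : ℝ) {ℓ k : ℕ} (hn : 1 ≤ (ℓ + 1) ^ k) (M : Fin (d + 1) → ℕ)
    {K : ℕ} (hK1 : 1 ≤ K) (hKM : ∀ μ, K ∣ M μ) (hnK : 3 ≤ (ℓ + 1) ^ k * K)
    (B : ↥(Box d ℓ k M) → ↥(Box d ℓ k M) → ℝ) (G : Matrix (↥(Box d ℓ k M) × ι) (↥(Box d ℓ k M) × ι) ℝ)
    (j : Fin (d + 1) → ℤ) {cG cD : ℝ} (hcG : 0 ≤ cG) (hcD : 0 ≤ cD)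
    (hG : ∀ Φ : ↥(Box d ℓ k M) × ι → ℝ, supN (G *ᵥ Φ) ≤ cG * supN Φ) (μ : Fin (d + 1))
    (hDG : ∀ Φ : ↥(Box d ℓ k M) × ι → ℝ, supN (derivA d F κ ℓ k M B μ *ᵥ (G *ᵥ Φ)) ≤ cD * supN Φ)
    (a : ↥(Box d ℓ k M)) (haμ : a.1 + e1 μ ∈ Box d ℓ k M) :
    ‖((((ℓ + 1) ^ k : ℕ) : ℝ) • (unitOp a ⟨a.1 + e1 μ, haμ⟩ (fieldLink F κ B a ⟨a.1 + e1 μ, haμ⟩)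
          - unitOp a a (1 : Matrix ι ι ℝ)))
        * (mulH (ι := ι) (fun z => hCube (K : ℝ) j (posR ℓ k M z)) * G
            * mulH (ι := ι) (fun z => hCube (K : ℝ) j (posR ℓ k M z)))‖
      ≤ Real.sqrt (Fintype.card ι) * cD
          + ((d : ℝ) + 1) * (D1 hprof + D2 hprof) / K
              * ((Fintype.card ι : ℝ) * (Real.sqrt (Fintype.card ι) * cG)) := by
  classical
  have hnr : (0 : ℝ) < (((ℓ + 1) ^ k : ℕ) : ℝ) := by exact_mod_cast hn
  have hKr : (0 : ℝ) < K := by exact_mod_cast hK1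
  have hs0 : 0 ≤ ((d : ℝ) + 1) * (D1 hprof + D2 hprof) := by
    have := D1_nonneg contDiff_hprof hasCompactSupport_hprof
    have := D2_nonneg contDiff_hprof hasCompactSupport_hprof
    positivity
  set b : ↥(Box d ℓ k M) := ⟨a.1 + e1 μ, haμ⟩ with hb
  have hbn : b.1 ∈ nbrs a.1 := mem_nbrs.2 ⟨μ, Or.inl rfl⟩
  set hh : ↥(Box d ℓ k M) → ℝ := fun z => hCube (K : ℝ) j (posR ℓ k M z) with hhh
  have hh_abs : ∀ z, |hh z| ≤ 1 := fun z => by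
    rw [hhh]; dsimp only; rw [abs_of_nonneg (hCube_nonneg _ _ _)]; exact hCube_le_one _ _ _
  set Wab : Matrix ι ι ℝ := fieldLink F κ B a b with hWab
  set Pr : Matrix (↥(Box d ℓ k M) × ι) (↥(Box d ℓ k M) × ι) ℝ :=
    ((((ℓ + 1) ^ k : ℕ)) : ℝ) • (unitOp a b Wab - unitOp a a (1 : Matrix ι ι ℝ)) with hPr
  have hw : ∀ k', ∑ k'', |Wab k' k''| ≤ (Fintype.card ι : ℝ) := fun k' => row_abs_sum_U_le F _ k'
  have hMh : ‖mulH (ι := ι) hh‖ ≤ 1 := norm_mulH_le _ zero_le_one hh_abs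
  have hGn : ‖G‖ ≤ Real.sqrt (Fintype.card ι) * cG := linfty_opNorm_le_of_supN _ hcG hG
  have hE : ‖unitOp a b Wab‖ ≤ (Fintype.card ι : ℝ) := norm_unitOp_le a b Wab (Nat.cast_nonneg _) hw
  -- `η^{-1}|h_j(b) − h_j(a)| ≤ s/K`
  have hgrad : |((((ℓ + 1) ^ k : ℕ)) : ℝ) * (hh b - hh a)| ≤ ((d : ℝ) + 1) * (D1 hprof + D2 hprof) / K := by
    rw [abs_mul, abs_of_pos hnr]
    exact (hsize_hBox hn hK1 hnK hKM j).grad_le a b (mem_boxNbrs_iff.2 hbn)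
  -- the first Leibniz term
  have hfirst : |hh a| * ‖Pr * G * mulH (ι := ι) hh‖ ≤ Real.sqrt (Fintype.card ι) * cD := by
    have hPG : ‖Pr * G‖ ≤ Real.sqrt (Fintype.card ι) * cD := by
      refine linfty_opNorm_le_of_supN _ hcD fun Φ => ?_
      rw [← Matrix.mulVec_mulVec]
      refine supN_le (mul_nonneg hcD (supN_nonneg Φ)) fun z => ?_
      by_cases hz : z = a
      · subst hz
        rw [hPr, fld_probe_mulVec_self, hWab, ← fld_covDeriv_mulVec_of_mem ((ℓ + 1) ^ k)
          (fieldLink F κ B) (G *ᵥ Φ) haμ]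
        exact (le_supN _ _).trans (hDG Φ)
      · rw [hPr, fld_probe_mulVec_ne _ _ _ _ _ hz, siteNorm_zero]
        exact mul_nonneg hcD (supN_nonneg Φ)
    calc |hh a| * ‖Pr * G * mulH (ι := ι) hh‖
        ≤ 1 * (‖Pr * G‖ * ‖mulH (ι := ι) hh‖) :=
          mul_le_mul (hh_abs a) (norm_mul_le _ _) (norm_nonneg _) zero_le_one
      _ ≤ 1 * (Real.sqrt (Fintype.card ι) * cD * 1) := by
          refine mul_le_mul_of_nonneg_left (mul_le_mul hPG hMh (norm_nonneg _) (by positivity)) zero_le_one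
      _ = Real.sqrt (Fintype.card ι) * cD := by ring
  have hsecond : |((((ℓ + 1) ^ k : ℕ)) : ℝ) * (hh b - hh a)| * ‖unitOp a b Wab * G * mulH (ι := ι) hh‖
      ≤ ((d : ℝ) + 1) * (D1 hprof + D2 hprof) / K
          * ((Fintype.card ι : ℝ) * (Real.sqrt (Fintype.card ι) * cG)) := by
    refine mul_le_mul hgrad ?_ (norm_nonneg _) (div_nonneg hs0 hKr.le)
    calc ‖unitOp a b Wab * G * mulH (ι := ι) hh‖
        ≤ ‖unitOp a b Wab‖ * ‖G‖ * ‖mulH (ι := ι) hh‖ :=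
          (norm_mul_le _ _).trans (mul_le_mul_of_nonneg_right (norm_mul_le _ _) (norm_nonneg _))
      _ ≤ (Fintype.card ι : ℝ) * (Real.sqrt (Fintype.card ι) * cG) * 1 :=
          mul_le_mul (mul_le_mul hE hGn (norm_nonneg _) (Nat.cast_nonneg _)) hMh (norm_nonneg _) (by positivity)
      _ = (Fintype.card ι : ℝ) * (Real.sqrt (Fintype.card ι) * cG) := mul_one _
  have hsplit : Pr * (mulH (ι := ι) hh * G * mulH (ι := ι) hh)
      = hh a • (Pr * G * mulH (ι := ι) hh)
        + (((((ℓ + 1) ^ k : ℕ)) : ℝ) * (hh b - hh a)) • (unitOp a b Wab * G * mulH (ι := ι) hh) := by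
    rw [show Pr * (mulH (ι := ι) hh * G * mulH (ι := ι) hh) = Pr * mulH (ι := ι) hh * G * mulH (ι := ι) hh by
        simp only [Matrix.mul_assoc], hPr, probe_mul_mulH]
    simp only [Matrix.add_mul, Matrix.smul_mul]
  show ‖Pr * (mulH (ι := ι) hh * G * mulH (ι := ι) hh)‖ ≤ _
  rw [hsplit]
  refine (norm_add_le _ _).trans ?_
  rw [norm_smul, norm_smul, Real.norm_eq_abs, Real.norm_eq_abs]
  exact add_le_add hfirst hsecond

end Letter

/-! ## §3. THEOREM (1.10), derivative member, on a box — the probe route with the CUT cubes -/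

section Route

/-- **THEOREM (1.10) ON A BOX `Ω`, DERIVATIVE MEMBER, WITH THE PRINT's CUT CUBES** — r01's probe route assembled with
`S_j := □_j`, `G_j := pad(G_k(□_j, Ã_j|□_j)) + cinv`.  Data as in `B4Thm110BoxCut.thm110_value_boxCut` (box `Ω = Box d ℓ k Mb`,
`d ≥ 1`, `1 ≤ Mb_μ`, `K ∣ Mb_μ`, `8 ≤ K`, `4 ∣ K`; arbitrary `A`; cube configurations `Ã_j` agreeing with `A` on the
plateaus), and for every `j ∈ labelsK Mb K`, ON THE SUB-BOX `□_j`: `‖G_k(□_j,Ã_j|□_j)Φ‖_∞ ≤ c_G‖Φ‖_∞`,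
`‖D^η_{Ã_j|□_j,μ}G_k(□_j,Ã_j|□_j)Φ‖_∞ ≤ c_D‖Φ‖_∞` (Lemma 2.2 (2.17), `n = 0, 1`), `‖K_hG_k(□_j,Ã_j|□_j)hΦ‖_∞ ≤ c_K‖Φ‖_∞`
(`h = hBox n K (cubeMs j) (jloc j)`, (2.20)), `3^{d+1}√N c_K ≤ e^{−1}`.  Then for `x, x + e_μ ∈ Ω` and `f` supported in a
set `P` at unit-lattice sup-distance `≥ D` from `x`, `|f| ≤ φ`:
`|(D^η_{A,μ}G_k(Ω,A)f)(x)_i| ≤ 2^{d+3}e^{19/8}·(√N c_D + (s/K)·N√N c_G)·e^{−D/K}·φ`, `s = (d+1)(sup|h′| + sup|h″|)` — the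
per-cube `α_P` comes from the sub-box by padding (`‖P·pad(L)‖ = ‖pad(P_□·L)‖ = ‖P_□·L‖`, `probe_letter_norm_le`).
[cite: Balaban1983RegularityDecay, Theorem (1.10) p.573; (2.2)/(2.6) pp.575–576, (2.3) p.575, (2.13) p.577, (2.18)–(2.22) pp.578–579] -/
theorem thm110_deriv_boxCut (F : OrthFlow ι) (κ : ℝ) {ℓ k : ℕ} (hℓ : 1 ≤ ℓ) (hk : 1 ≤ k) (hn : 1 ≤ (ℓ + 1) ^ k)
    (hd : 1 ≤ d) (Mb : Fin (d + 1) → ℕ) (hMb : ∀ i, 1 ≤ Mb i) {K : ℕ} (hK8 : 8 ≤ K) (h4 : 4 ∣ K)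
    (hKM : ∀ μ, K ∣ Mb μ) {a m2 : ℝ} (ha : 0 < a) (hm : 0 ≤ m2)
    (A : ↥(Box d ℓ k Mb) → ↥(Box d ℓ k Mb) → ℝ)
    (At : (Fin (d + 1) → ℤ) → ↥(Box d ℓ k Mb) → ↥(Box d ℓ k Mb) → ℝ)
    (hplat : ∀ j (u v : ↥(Box d ℓ k Mb)), (∀ ν, |posR ℓ k Mb u ν - (K : ℝ) * j ν| ≤ 3 / 4 * (K : ℝ)) →
      (∀ ν, |posR ℓ k Mb v ν - (K : ℝ) * j ν| ≤ 3 / 4 * (K : ℝ)) → At j u v = A u v)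
    {cG cD cK : ℝ} (hcG : 0 ≤ cG) (hcD : 0 ≤ cD) (hcK : 0 ≤ cK)
    (hG : ∀ j ∈ labelsK Mb K, ∀ Φ : ↥(Box d ℓ k (cubeMs Mb K j)) × ι → ℝ,
      supN (greenA d F κ ℓ k a m2 (cubeMs Mb K j) (baseEmb hn _) (stairContour hn _)
          (subField ℓ k Mb (cubeMs Mb K j) (cubeLo Mb K j) (cube_ho Mb K j) (At j)) *ᵥ Φ) ≤ cG * supN Φ)
    (μ : Fin (d + 1))
    (hDG : ∀ j ∈ labelsK Mb K, ∀ Φ : ↥(Box d ℓ k (cubeMs Mb K j)) × ι → ℝ,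
      supN (derivA d F κ ℓ k (cubeMs Mb K j) (subField ℓ k Mb (cubeMs Mb K j) (cubeLo Mb K j) (cube_ho Mb K j) (At j)) μ
        *ᵥ (greenA d F κ ℓ k a m2 (cubeMs Mb K j) (baseEmb hn _) (stairContour hn _)
            (subField ℓ k Mb (cubeMs Mb K j) (cubeLo Mb K j) (cube_ho Mb K j) (At j)) *ᵥ Φ)) ≤ cD * supN Φ)
    (hKG : ∀ j ∈ labelsK Mb K, ∀ Φ : ↥(Box d ℓ k (cubeMs Mb K j)) × ι → ℝ,
      supN (kOp F κ ((ℓ + 1) ^ k) (B1.aSeq a ((ℓ : ℝ) + 1) k) m2 (cubeMs Mb K j) (baseEmb hn _) (stairContour hn _)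
            (subField ℓ k Mb (cubeMs Mb K j) (cubeLo Mb K j) (cube_ho Mb K j) (At j))
            (hBox ((ℓ + 1) ^ k) K (cubeMs Mb K j) (jloc j))
          *ᵥ (greenA d F κ ℓ k a m2 (cubeMs Mb K j) (baseEmb hn _) (stairContour hn _)
              (subField ℓ k Mb (cubeMs Mb K j) (cubeLo Mb K j) (cube_ho Mb K j) (At j))
            *ᵥ (mulH (ι := ι) (hBox ((ℓ + 1) ^ k) K (cubeMs Mb K j) (jloc j)) *ᵥ Φ))) ≤ cK * supN Φ)
    (h3 : (3 : ℝ) ^ (d + 1) * (Real.sqrt (Fintype.card ι) * cK) ≤ Real.exp (-1))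
    (x : ↥(Box d ℓ k Mb)) (hxμ : x.1 + e1 μ ∈ Box d ℓ k Mb) (P : ↥(Box d ℓ k Mb) → Prop) [DecidablePred P]
    {D : ℝ} (hD : ∀ x', P x' → ∃ ν, D ≤ |posR ℓ k Mb x ν - posR ℓ k Mb x' ν|)
    (f : ↥(Box d ℓ k Mb) × ι → ℝ) (hfP : ∀ p, ¬ P p.1 → f p = 0) {φ : ℝ} (hφ : 0 ≤ φ) (hf : ∀ p, |f p| ≤ φ)
    (i : ι) :
    |(derivA d F κ ℓ k Mb A μ
        *ᵥ (greenA d F κ ℓ k a m2 Mb (baseEmb hn Mb) (stairContour hn Mb) A *ᵥ f)) (x, i)|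
      ≤ 2 ^ (d + 3) * Real.exp (19 / 8)
          * (Real.sqrt (Fintype.card ι) * cD
              + ((d : ℝ) + 1) * (D1 hprof + D2 hprof) / K
                  * ((Fintype.card ι : ℝ) * (Real.sqrt (Fintype.card ι) * cG)))
          * Real.exp (-(D / K)) * φ := by
  classical
  have hK1 : 1 ≤ K := le_trans (by norm_num) hK8
  have hKr : (0 : ℝ) < K := by exact_mod_cast hK1
  have hnr : (0 : ℝ) < (((ℓ + 1) ^ k : ℕ) : ℝ) := by exact_mod_cast hn
  have hn2' : 2 ≤ (ℓ + 1) ^ k := by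
    calc 2 ≤ ℓ + 1 := by omega
      _ = (ℓ + 1) ^ 1 := (pow_one _).symm
      _ ≤ (ℓ + 1) ^ k := Nat.pow_le_pow_right (Nat.succ_pos ℓ) hk
  have hn2 : ∀ i, 2 ≤ (ℓ + 1) ^ k * Mb i := fun i => by nlinarith [hMb i]
  have hnK : 3 ≤ (ℓ + 1) ^ k * K := by nlinarith
  have hs0 : 0 ≤ ((d : ℝ) + 1) * (D1 hprof + D2 hprof) := by
    have := D1_nonneg contDiff_hprof hasCompactSupport_hprof
    have := D2_nonneg contDiff_hprof hasCompactSupport_hprof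
    positivity
  -- the bond `⟨x, y⟩`
  set y : ↥(Box d ℓ k Mb) := ⟨x.1 + e1 μ, hxμ⟩ with hy
  have hyn : y.1 ∈ nbrs x.1 := mem_nbrs.2 ⟨μ, Or.inl rfl⟩
  have hxy : ∀ ν, |posR ℓ k Mb x ν - posR ℓ k Mb y ν| ≤ 1 / 8 * (K : ℝ) := by
    refine boxWt_local hK8 ?_
    unfold boxWt
    rw [if_pos hyn, mul_one]
    positivity
  -- abbreviations
  set Gr : (Fin (d + 1) → ℤ) → Matrix (↥(Box d ℓ k Mb) × ι) (↥(Box d ℓ k Mb) × ι) ℝ :=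
    fun j => cubeGreen ℓ k Mb (cubeMs Mb K j) (cubeLo Mb K j) F κ (cube_ho Mb K j) hn a m2 (At j) with hGr
  set hh : (Fin (d + 1) → ℤ) → ↥(Box d ℓ k Mb) → ℝ := fun j z => hCube (K : ℝ) j (posR ℓ k Mb z) with hhh
  -- the probe
  set Wxy : Matrix ι ι ℝ := fieldLink F κ A x y with hWxy
  set Pr : Matrix (↥(Box d ℓ k Mb) × ι) (↥(Box d ℓ k Mb) × ι) ℝ :=
    ((((ℓ + 1) ^ k : ℕ)) : ℝ) • (unitOp x y Wxy - unitOp x x (1 : Matrix ι ι ℝ)) with hPr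
  -- the starting cubes `S₀` (those seeing `x` or `y`), at most `2^{d+2}`, within `¾K` of `x`
  set S₀ : Finset ↥(labelsK Mb K) := Finset.univ.filter fun j => hh j.1 x ≠ 0 ∨ hh j.1 y ≠ 0 with hS₀
  have hcard : S₀.card ≤ 2 ^ (d + 2) := by
    have hsub : S₀.map (Function.Embedding.subtype (· ∈ labelsK Mb K))
        ⊆ (Fintype.piFinset fun ν => ({⌊posR ℓ k Mb x ν / K⌋, ⌊posR ℓ k Mb x ν / K⌋ + 1} : Finset ℤ))
          ∪ (Fintype.piFinset fun ν => ({⌊posR ℓ k Mb y ν / K⌋, ⌊posR ℓ k Mb y ν / K⌋ + 1} : Finset ℤ)) := by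
      intro j hj
      obtain ⟨i', hi', rfl⟩ := Finset.mem_map.mp hj
      obtain ⟨-, hixy⟩ := Finset.mem_filter.mp hi'
      rcases hixy with hix | hiy
      · exact Finset.mem_union_left _ (mem_box_of_hCube_ne_zero hix)
      · exact Finset.mem_union_right _ (mem_box_of_hCube_ne_zero hiy)
    calc S₀.card = (S₀.map (Function.Embedding.subtype (· ∈ labelsK Mb K))).card := (Finset.card_map _).symm
      _ ≤ _ := Finset.card_le_card hsub
      _ ≤ _ := Finset.card_union_le _ _
      _ ≤ 2 ^ (d + 1) + 2 ^ (d + 1) :=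
          add_le_add (card_labelBox_le (K : ℝ) (posR ℓ k Mb x)) (card_labelBox_le (K : ℝ) (posR ℓ k Mb y))
      _ = 2 ^ (d + 2) := by ring
  have hP0' : ∀ j : ↥(labelsK Mb K), j ∉ S₀ → Pr * mulH (ι := ι) (hh j.1) = 0 := by
    intro j hj
    have hjx : hh j.1 x = 0 := by
      by_contra h0; exact hj (Finset.mem_filter.mpr ⟨Finset.mem_univ _, Or.inl h0⟩)
    have hjy : hh j.1 y = 0 := by
      by_contra h0; exact hj (Finset.mem_filter.mpr ⟨Finset.mem_univ _, Or.inr h0⟩)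
    rw [hPr, probe_mul_mulH, hjx, hjy, sub_zero, mul_zero, zero_smul, zero_smul, add_zero]
  have hnear : ∀ j : Fin (d + 1) → ℤ, (hh j x ≠ 0 ∨ hh j y ≠ 0) →
      ∀ ν, |posR ℓ k Mb x ν - (K : ℝ) * j ν| < 3 / 4 * (K : ℝ) := by
    intro j hj ν
    rcases hj with hjx | hjy
    · exact (hCube_ne_zero_imp hKr hjx ν).trans (by nlinarith)
    · have h1 := hCube_ne_zero_imp hKr hjy ν
      have h2 := hxy ν
      calc |posR ℓ k Mb x ν - (K : ℝ) * j ν|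
          ≤ |posR ℓ k Mb x ν - posR ℓ k Mb y ν| + |posR ℓ k Mb y ν - (K : ℝ) * j ν| := abs_sub_le _ _ _
        _ < 1 / 8 * (K : ℝ) + 5 / 8 * (K : ℝ) := add_lt_add_of_le_of_lt h2 h1
        _ = 3 / 4 * (K : ℝ) := by ring
  have hS₀ρ : ∀ j ∈ S₀, ∀ ν, |posR ℓ k Mb x ν - (K : ℝ) * j.1 ν| < 3 / 4 * (K : ℝ) := fun j hj =>
    hnear j.1 (Finset.mem_filter.mp hj).2
  have hplx : ∀ j : Fin (d + 1) → ℤ, (hh j x ≠ 0 ∨ hh j y ≠ 0) →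
      (∀ ν, |posR ℓ k Mb x ν - (K : ℝ) * j ν| ≤ 3 / 4 * (K : ℝ)) ∧
      (∀ ν, |posR ℓ k Mb y ν - (K : ℝ) * j ν| ≤ 3 / 4 * (K : ℝ)) := by
    intro j hj
    refine ⟨fun ν => (hnear j hj ν).le, fun ν => ?_⟩
    rcases hj with hjx | hjy
    · have h1 := hCube_ne_zero_imp hKr hjx ν
      have h2 := hxy ν
      rw [abs_sub_comm] at h2
      calc |posR ℓ k Mb y ν - (K : ℝ) * j ν|
          ≤ |posR ℓ k Mb y ν - posR ℓ k Mb x ν| + |posR ℓ k Mb x ν - (K : ℝ) * j ν| := abs_sub_le _ _ _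
        _ ≤ 1 / 8 * (K : ℝ) + 5 / 8 * (K : ℝ) := add_le_add h2 h1.le
        _ = 3 / 4 * (K : ℝ) := by ring
    · exact (hCube_ne_zero_imp hKr hjy ν).le.trans (by nlinarith)
  -- the per-cube input `α_P`: by padding, the Leibniz estimate on the sub-box
  set αP : ℝ := Real.sqrt (Fintype.card ι) * cD
    + ((d : ℝ) + 1) * (D1 hprof + D2 hprof) / K
        * ((Fintype.card ι : ℝ) * (Real.sqrt (Fintype.card ι) * cG)) with hαP
  have hαP0 : 0 ≤ αP := by positivity
  have hαPj : ∀ j : ↥(labelsK Mb K), ‖Pr * (mulH (ι := ι) (hh j.1) * Gr j.1 * mulH (ι := ι) (hh j.1))‖ ≤ αP := by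
    intro j
    by_cases hjS : j ∈ S₀
    · -- `x` and `y` are plateau points of `□_j`, hence sites of the sub-box
      have hpl := hplx j.1 (Finset.mem_filter.mp hjS).2
      have ho := cube_ho Mb K j.1
      have he : Function.Injective (subEmb ℓ k Mb (cubeMs Mb K j.1) (cubeLo Mb K j.1) ho) :=
        subEmb_injective ℓ k Mb _ _ ho
      obtain ⟨a', ha'⟩ := (inSub_iff ℓ k Mb (cubeMs Mb K j.1) (cubeLo Mb K j.1) ho x).1
        (cubeS_of_plateau hK1 j.1 x hpl.1)
      obtain ⟨b', hb'⟩ := (inSub_iff ℓ k Mb (cubeMs Mb K j.1) (cubeLo Mb K j.1) ho y).1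
        (cubeS_of_plateau hK1 j.1 y hpl.2)
      have hea : ∀ c : ↥(Box d ℓ k (cubeMs Mb K j.1)), (subEmb ℓ k Mb (cubeMs Mb K j.1) (cubeLo Mb K j.1) ho c).1
          = c.1 + fun i => (((ℓ + 1) ^ k : ℕ) : ℤ) * (cubeLo Mb K j.1 i : ℤ) := fun c => rfl
      have hab : b'.1 = a'.1 + e1 μ := by
        have h1 : (subEmb ℓ k Mb (cubeMs Mb K j.1) (cubeLo Mb K j.1) ho b').1
            = (subEmb ℓ k Mb (cubeMs Mb K j.1) (cubeLo Mb K j.1) ho a').1 + e1 μ := by rw [ha', hb']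
        rw [hea, hea, add_right_comm] at h1
        exact add_right_cancel h1
      have haμ : a'.1 + e1 μ ∈ Box d ℓ k (cubeMs Mb K j.1) := by rw [← hab]; exact b'.2
      have hb'eq : b' = ⟨a'.1 + e1 μ, haμ⟩ := Subtype.ext hab
      -- the letter is the padded sub-box letter
      have hL := cube_letter_a ℓ k Mb (cubeMs Mb K j.1) (cubeLo Mb K j.1) F κ ho hn a m2 (At j.1) (hh j.1)
        (fun z hz => cubeS_of_hCube_ne_zero hK1 j.1 z hz)
      have hhsub : (fun c : ↥(Box d ℓ k (cubeMs Mb K j.1)) =>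
          hh j.1 (subEmb ℓ k Mb (cubeMs Mb K j.1) (cubeLo Mb K j.1) ho c))
          = fun c => hCube (K : ℝ) (jloc j.1) (posR ℓ k (cubeMs Mb K j.1) c) := by
        funext c
        rw [hhh]
        exact (hCube_subEmb hK1 hKM j.2 c).trans (by rw [← hCube_posR_eq_hBox])
      -- the probe is the padded sub-box probe, with the same link matrix
      have hW : Wxy = fieldLink F κ (subField ℓ k Mb (cubeMs Mb K j.1) (cubeLo Mb K j.1) ho (At j.1))
          a' ⟨a'.1 + e1 μ, haμ⟩ := by
        rw [hWxy, ← hb'eq]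
        show F.U (κ * A x y) = F.U (κ * At j.1 (subEmb ℓ k Mb (cubeMs Mb K j.1) (cubeLo Mb K j.1) ho a')
          (subEmb ℓ k Mb (cubeMs Mb K j.1) (cubeLo Mb K j.1) ho b'))
        rw [ha', hb', hplat j.1 x y hpl.1 hpl.2]
      have hPpad : Pr = pad (subEmb ℓ k Mb (cubeMs Mb K j.1) (cubeLo Mb K j.1) ho)
          ((((ℓ + 1) ^ k : ℕ) : ℝ) • (unitOp a' ⟨a'.1 + e1 μ, haμ⟩ Wxy - unitOp a' a' (1 : Matrix ι ι ℝ))) := by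
        rw [hPr, ← probe_eq_pad he, ← hb'eq, ha', hb']
      rw [hGr]
      dsimp only
      rw [hL, hPpad, pad_mul he, norm_pad he, hhsub, hW]
      exact probe_letter_norm_le F κ hn (cubeMs Mb K j.1) hK1 (fun ν => dvd_cubeMs hK1 hKM hMb j.2 ν) (by
          have := one_le_cubeMs hK1 hKM hMb j.2 μ; nlinarith)
        (subField ℓ k Mb (cubeMs Mb K j.1) (cubeLo Mb K j.1) ho (At j.1)) _ (jloc j.1) hcG hcD (hG j.1 j.2) μ
        (hDG j.1 j.2) a' haμ
    · rw [show Pr * (mulH (ι := ι) (hh j.1) * Gr j.1 * mulH (ι := ι) (hh j.1))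
          = Pr * mulH (ι := ι) (hh j.1) * Gr j.1 * mulH (ι := ι) (hh j.1) by simp only [Matrix.mul_assoc],
        hP0' j hjS, Matrix.zero_mul, Matrix.zero_mul, norm_zero]
      exact hαP0
  -- the walk route for the probe
  have main := probe_bound (X := ↥(Box d ℓ k Mb)) (Y := ↥(boxDom Mb)) (κ := ι) hKr (posR ℓ k Mb)
    (boxWt ((ℓ + 1) ^ k) (fun i => (ℓ + 1) ^ k * Mb i)) m2
    (B1.aSeq a ((ℓ : ℝ) + 1) k * (((((ℓ + 1) ^ k : ℕ)) : ℝ) ^ (d + 1))⁻¹)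
    (blkWt ((ℓ + 1) ^ k) Mb (fun i => (ℓ + 1) ^ k * Mb i)) (fieldLink F κ A)
    (contourTrans (fieldLink F κ A) (baseEmb hn Mb) (stairContour hn Mb))
    (fun _ _ h => boxWt_local hK8 h) (fun _ _ _ h h' => blkWt_local hK8 h h')
    (labelsK Mb K) (fun j z h => mem_labelsK_of_hCube_ne_zero hK1 hKM j z h)
    (fun j => cubeS ℓ k Mb K j) (fun j z hz => cubeS_of_near hK1 j z hz)
    (fun j => cubeW ℓ k Mb (cubeMs Mb K j) (cubeLo Mb K j) F κ (At j))
    (fun j => cubeT ℓ k Mb (cubeMs Mb K j) (cubeLo Mb K j) F κ hn (At j))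
    (fun j u v hu hv => by
      show (if inSub ℓ k Mb (cubeMs Mb K j) (cubeLo Mb K j) u ∧ inSub ℓ k Mb (cubeMs Mb K j) (cubeLo Mb K j) v
        then fieldLink F κ (At j) u v else 0) = fieldLink F κ A u v
      rw [if_pos ⟨cubeS_of_plateau hK1 j u hu, cubeS_of_plateau hK1 j v hv⟩]
      show F.U (κ * At j u v) = F.U (κ * A u v)
      rw [hplat j u v hu hv])
    (fun j y' u hq hu => by
      show (if inSub ℓ k Mb (cubeMs Mb K j) (cubeLo Mb K j) u then
        contourTrans (fieldLink F κ (At j)) (baseEmb hn Mb) (stairContour hn Mb) y' u else 0)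
        = contourTrans (fieldLink F κ A) (baseEmb hn Mb) (stairContour hn Mb) y' u
      rw [if_pos (cubeS_of_plateau hK1 j u hu)]
      exact contourTrans_plateau F κ h4 hn (hplat j) hu hq)
    Gr
    (fun j _ => cubeOp_mul_cubeGreen ℓ k Mb _ _ F κ (cube_ho Mb K j) hℓ hk hn ha hm hd hn2 (At j))
    (greenA d F κ ℓ k a m2 Mb (baseEmb hn Mb) (stairContour hn Mb) A)
    (Matrix.nonsing_inv_mul _ (opA_stair_isUnit_det F κ hℓ hk hn ha hm Mb A))
    Pr S₀ (m₀ := 2 ^ (d + 2)) hcard hP0' x (ρ := 3 / 4) hS₀ρ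
    (β := Real.sqrt (Fintype.card ι) * cK) hαP0 hαPj (by positivity)
    (fun j => by
      rw [hGr]
      dsimp only
      rw [cube_letter_b ℓ k Mb _ _ F κ (cube_ho Mb K j.1) hn a m2 (At j.1) _
        (fun z hz => cubeS_of_hCube_ne_zero hK1 j.1 z hz), norm_pad (subEmb_injective ℓ k Mb _ _ _)]
      refine linfty_opNorm_le_of_supN _ hcK fun Φ => ?_
      have hh' : (fun b : ↥(Box d ℓ k (cubeMs Mb K j.1)) =>
          hCube (K : ℝ) j.1 (posR ℓ k Mb (subEmb ℓ k Mb (cubeMs Mb K j.1) (cubeLo Mb K j.1) (cube_ho Mb K j.1) b)))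
          = hBox ((ℓ + 1) ^ k) K (cubeMs Mb K j.1) (jloc j.1) :=
        funext fun b => hCube_subEmb hK1 hKM j.2 b
      rw [hh', ← Matrix.mulVec_mulVec, ← Matrix.mulVec_mulVec]
      exact hKG j.1 j.2 Φ)
    h3 P hD
  -- the entry `(x, i)` of `P·G·1_P f = D^η_{A,μ}G f`
  have h1P : mulH (ι := ι) (fun z => if P z then (1 : ℝ) else 0) *ᵥ f = f := by
    ext p
    rw [B4Ineq110WalkRoute.mulH_mulVec_apply]
    by_cases hz : P p.1
    · rw [if_pos hz, one_mul]
    · rw [if_neg hz, zero_mul, hfP p hz]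
  have hentry : ((Pr * greenA d F κ ℓ k a m2 Mb (baseEmb hn Mb) (stairContour hn Mb) A
      * mulH (ι := ι) (fun z => if P z then (1 : ℝ) else 0)) *ᵥ f) (x, i)
      = (derivA d F κ ℓ k Mb A μ
          *ᵥ (greenA d F κ ℓ k a m2 Mb (baseEmb hn Mb) (stairContour hn Mb) A *ᵥ f)) (x, i) := by
    rw [← Matrix.mulVec_mulVec, ← Matrix.mulVec_mulVec, h1P]
    have h1 := fld_probe_mulVec_self x y Wxy ((((ℓ + 1) ^ k : ℕ)) : ℝ)
      (greenA d F κ ℓ k a m2 Mb (baseEmb hn Mb) (stairContour hn Mb) A *ᵥ f)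
    have h2 := fld_covDeriv_mulVec_of_mem ((ℓ + 1) ^ k) (fieldLink F κ A)
      (greenA d F κ ℓ k a m2 Mb (baseEmb hn Mb) (stairContour hn Mb) A *ᵥ f) (μ := μ) hxμ
    have h12 := h1.trans h2.symm
    exact congrFun h12 i
  rw [← hentry]
  refine (abs_mulVec_le _ f hφ hf (x, i)).trans ?_
  refine mul_le_mul_of_nonneg_right (main.trans (le_of_eq ?_)) hφ
  rw [show (3 : ℝ) / 4 + 13 / 8 = 19 / 8 by norm_num]
  push_cast
  ring

/-- **THEOREM (1.10), DERIVATIVE MEMBER, ON A BOX WITH THE CUT CUBES, FOR `A = compField Ac` AND p35's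
`Ã_j = A₀ + θ_j(A − A₀)`** with a per-label base value `A₀ j`: plateau agreement = `cubeField_eq_compField`; the inputs are
about the cube configuration of the translated field on the sub-box (`subField_cubeField`).
[cite: Balaban1983RegularityDecay, Theorem (1.10) p.573; §2 pp.575–579] -/
theorem thm110_deriv_boxCut_cubeField (F : OrthFlow ι) {ℓ k : ℕ} (hℓ : 1 ≤ ℓ) (hk : 1 ≤ k) (hn : 1 ≤ (ℓ + 1) ^ k)
    (hd : 1 ≤ d) (Mb : Fin (d + 1) → ℕ) (hMb : ∀ i, 1 ≤ Mb i) {K : ℕ} (hK8 : 8 ≤ K) (h4 : 4 ∣ K)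
    (hKM : ∀ μ, K ∣ Mb μ) {a m2 : ℝ} (ha : 0 < a) (hm : 0 ≤ m2) (e : ℝ)
    (Ac : (Fin (d + 1) → ℤ) → Fin (d + 1) → ℝ) (A₀ : (Fin (d + 1) → ℤ) → Fin (d + 1) → ℝ)
    {cG cD cK : ℝ} (hcG : 0 ≤ cG) (hcD : 0 ≤ cD) (hcK : 0 ≤ cK)
    (hG : ∀ j ∈ labelsK Mb K, ∀ Φ : ↥(Box d ℓ k (cubeMs Mb K j)) × ι → ℝ,
      supN (greenA d F (e / ((ℓ + 1) ^ k : ℕ)) ℓ k a m2 (cubeMs Mb K j) (baseEmb hn _) (stairContour hn _)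
          (cubeField (Box d ℓ k (cubeMs Mb K j)) ((ℓ + 1) ^ k) K (jloc j) (A₀ j)
            (fun y => Ac (y + fun i => (((ℓ + 1) ^ k : ℕ) : ℤ) * (cubeLo Mb K j i : ℤ)))) *ᵥ Φ) ≤ cG * supN Φ)
    (μ : Fin (d + 1))
    (hDG : ∀ j ∈ labelsK Mb K, ∀ Φ : ↥(Box d ℓ k (cubeMs Mb K j)) × ι → ℝ,
      supN (derivA d F (e / ((ℓ + 1) ^ k : ℕ)) ℓ k (cubeMs Mb K j)
          (cubeField (Box d ℓ k (cubeMs Mb K j)) ((ℓ + 1) ^ k) K (jloc j) (A₀ j)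
            (fun y => Ac (y + fun i => (((ℓ + 1) ^ k : ℕ) : ℤ) * (cubeLo Mb K j i : ℤ)))) μ
        *ᵥ (greenA d F (e / ((ℓ + 1) ^ k : ℕ)) ℓ k a m2 (cubeMs Mb K j) (baseEmb hn _) (stairContour hn _)
          (cubeField (Box d ℓ k (cubeMs Mb K j)) ((ℓ + 1) ^ k) K (jloc j) (A₀ j)
            (fun y => Ac (y + fun i => (((ℓ + 1) ^ k : ℕ) : ℤ) * (cubeLo Mb K j i : ℤ)))) *ᵥ Φ)) ≤ cD * supN Φ)
    (hKG : ∀ j ∈ labelsK Mb K, ∀ Φ : ↥(Box d ℓ k (cubeMs Mb K j)) × ι → ℝ,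
      supN (kOp F (e / ((ℓ + 1) ^ k : ℕ)) ((ℓ + 1) ^ k) (B1.aSeq a ((ℓ : ℝ) + 1) k) m2 (cubeMs Mb K j)
            (baseEmb hn _) (stairContour hn _)
            (cubeField (Box d ℓ k (cubeMs Mb K j)) ((ℓ + 1) ^ k) K (jloc j) (A₀ j)
              (fun y => Ac (y + fun i => (((ℓ + 1) ^ k : ℕ) : ℤ) * (cubeLo Mb K j i : ℤ))))
            (hBox ((ℓ + 1) ^ k) K (cubeMs Mb K j) (jloc j))
          *ᵥ (greenA d F (e / ((ℓ + 1) ^ k : ℕ)) ℓ k a m2 (cubeMs Mb K j) (baseEmb hn _) (stairContour hn _)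
              (cubeField (Box d ℓ k (cubeMs Mb K j)) ((ℓ + 1) ^ k) K (jloc j) (A₀ j)
                (fun y => Ac (y + fun i => (((ℓ + 1) ^ k : ℕ) : ℤ) * (cubeLo Mb K j i : ℤ))))
            *ᵥ (mulH (ι := ι) (hBox ((ℓ + 1) ^ k) K (cubeMs Mb K j) (jloc j)) *ᵥ Φ))) ≤ cK * supN Φ)
    (h3 : (3 : ℝ) ^ (d + 1) * (Real.sqrt (Fintype.card ι) * cK) ≤ Real.exp (-1))
    (x : ↥(Box d ℓ k Mb)) (hxμ : x.1 + e1 μ ∈ Box d ℓ k Mb) (P : ↥(Box d ℓ k Mb) → Prop) [DecidablePred P]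
    {D : ℝ} (hD : ∀ x', P x' → ∃ ν, D ≤ |posR ℓ k Mb x ν - posR ℓ k Mb x' ν|)
    (f : ↥(Box d ℓ k Mb) × ι → ℝ) (hfP : ∀ p, ¬ P p.1 → f p = 0) {φ : ℝ} (hφ : 0 ≤ φ) (hf : ∀ p, |f p| ≤ φ)
    (i : ι) :
    |(derivA d F (e / ((ℓ + 1) ^ k : ℕ)) ℓ k Mb (fun u v : ↥(Box d ℓ k Mb) => compField Ac u.1 v.1) μ
        *ᵥ (greenA d F (e / ((ℓ + 1) ^ k : ℕ)) ℓ k a m2 Mb (baseEmb hn Mb) (stairContour hn Mb)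
            (fun u v : ↥(Box d ℓ k Mb) => compField Ac u.1 v.1) *ᵥ f)) (x, i)|
      ≤ 2 ^ (d + 3) * Real.exp (19 / 8)
          * (Real.sqrt (Fintype.card ι) * cD
              + ((d : ℝ) + 1) * (D1 hprof + D2 hprof) / K
                  * ((Fintype.card ι : ℝ) * (Real.sqrt (Fintype.card ι) * cG)))
          * Real.exp (-(D / K)) * φ := by
  have hK1 : 1 ≤ K := le_trans (by norm_num) hK8
  have hsub : ∀ j ∈ labelsK Mb K, subField ℓ k Mb (cubeMs Mb K j) (cubeLo Mb K j) (cube_ho Mb K j)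
      (cubeField (Box d ℓ k Mb) ((ℓ + 1) ^ k) K j (A₀ j) Ac)
      = cubeField (Box d ℓ k (cubeMs Mb K j)) ((ℓ + 1) ^ k) K (jloc j) (A₀ j)
          (fun y => Ac (y + fun i => (((ℓ + 1) ^ k : ℕ) : ℤ) * (cubeLo Mb K j i : ℤ))) :=
    fun j hj => subField_cubeField hK1 hKM hj (A₀ j) Ac
  refine thm110_deriv_boxCut F (e / ((ℓ + 1) ^ k : ℕ)) hℓ hk hn hd Mb hMb hK8 h4 hKM ha hm
    (fun u v : ↥(Box d ℓ k Mb) => compField Ac u.1 v.1)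
    (fun j => cubeField (Box d ℓ k Mb) ((ℓ + 1) ^ k) K j (A₀ j) Ac)
    (fun j u v hu hv => cubeField_eq_compField hn hK1 j (A₀ j) Ac (fun ν => plateau_fine hu ν)
      (fun ν => plateau_fine hv ν))
    hcG hcD hcK (fun j hj Φ => ?_) μ (fun j hj Φ => ?_) (fun j hj Φ => ?_) h3 x hxμ P hD f hfP hφ hf i
  · rw [hsub j hj]; exact hG j hj Φ
  · rw [hsub j hj]; exact hDG j hj Φ
  · rw [hsub j hj]; exact hKG j hj Φ

end Route

end

end Literature.MathematicalPhysics.QuantumFieldTheory.Balaban1983to89.B4Thm110BoxDerivCut
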